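import Literature.NumberTheory.LFunctions.Zhang2022.KnifeEdgeEStarLen

/-!
# Zhang (2022), rung F-S3 (Landau–Siegel programme, family B-multi): the INTERIOR-JUMP term
# `E-multi-jump` typed over the skeleton (statement only), and its sign bookkeeping proved

Y. Zhang, *Discrete mean estimates and the Landau–Siegel zero*, arXiv:2211.02515v1 [Zhang2022LandauSiegel] —
an unrefereed manuscript under adjudication. **WHAT THIS IS NOT: not a claim about Theorems 1–2 of
arXiv:2211.02515, about Landau–Siegel zeros, or about Parity. The programme SEARCHES and TYPES; nothing here
asserts any estimate: `EMultiJump` is a bare `Prop` (cell `landau-siegel`, B-multi/EDLIST.md row multi-E1,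
alias E-multi-jump(h, z₀)), PARAMETRIC in the two objects its in-house derivation has to deliver — the jump
kernel `κ : ℝ → ℝ` and the balancing scale `Λ` — and every `theorem` is elementary bookkeeping about them.**

**The design class (sub-class M1 of B-multi/PLAN.md):** a coefficient profile on the logarithmic scale
`z = log n/log P ∈ [0,1]` made of a one-sided kinked part `u` (`Repair.KinkedProfile`, `u(1) = 0` — inside the
validated calculus, main term `𝔅(u) = mainTermForm u u′ ≥ 0`, `MainTermFormH1.mainTermForm_nonneg_of_isH1`) PLUS
finitely many sharp steps `η_i·𝟙_{[0,z_i)}` at interior heights `0 < z_i < 1` (a piece cut off sharply at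
`n = P^{z_i}`): `JumpData`, `JumpData.Admissible`, `stepFun`, `JumpData.profile`. Such a profile is OUTSIDE the
class on which formula I (Prop 7.1 + §8) is a main term: the manuscript bounds the neighbourhood of every breakpoint
by the crude (10.5)/(10.11) «≪ 𝓛⁻⁷», valid because its own profiles are `≪ α₁` there; a step of height `η ≠ 0`
instead carries the trivial-scale mean value `≍ |η|²·𝓛^{1.1}` against the dipole-suppressed regular part
`≍ 𝔞𝓛⁻⁹` (pub-zhang STRUCTURE.md §7; the cell's OBJECTIVE.md §1.3 «jumps inside (0,1) are not a lever»;
FEASIBILITY.md v1.0b §0.6). Hence two readings: fixed heights (the jump term dominates, sign `+`) or BALANCED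
heights `η_i = c_i·Λ^{−1/2}` with `Λ = Λ_J(D, χ) → ∞` the ratio of the two scales — then the jump contributes at
main order exactly `Σ_i |c_i|²κ(z_i)`, which is what the registry row states and what this file types.

**The row (Part 2) = multi-E1, alias E-multi-jump(h, z₀):** under (A), for every admissible jump datum, the
discrete mean (`KnifeEdge.discMean`, (2.16)–(2.20)/(8.3)) of the profile polynomial (`KnifeEdge.profPoly`, length
`⌈P⌉`) of the BALANCED profile `u + Σ_i c_iΛ(D,χ)^{−1/2}𝟙_{[0,z_i)}` equals
`(𝔅(u) + Σ_i |c_i|²κ(z_i))·𝔞𝔓 + o(𝔞𝔓)` — `EMultiJump c' κ Λ`, in the `ForAllLarge … AssumptionA → |mean − main·𝔞𝔓|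
≤ ε𝔞𝔓` shape of `KnifeEdge.EStarLen` / `Skeleton.Eval823`; the claimed sign `κ > 0` on `(0,1)` is the separate
predicate `JumpKernelPos κ`. STATUS: derivation (in-house, unreviewed; S–M from Prop 7.1 / Lemma 10.1 (10.5);
cross terms jump × smooth are of dipole order `× η_i → 0` and jump × jump at distinct heights vanish at the trivial
scale, so neither appears in the balanced main term). `κ` and `Λ` are NOT defined here (no closed form is in print or
in the cell's files as of this typing; the EDLIST's definition request D-multi-2 `jumpKappa` is answered by this
parametrisation until ls-theory's derivation supplies the closed form, which then instantiates `κ`).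

**Proved (Part 3), the (B1) bookkeeping that DECIDES sub-class M1 given the sign:** for `κ ≥ 0` on `(0,1)` the
balanced main term is `≥ 𝔅(u) ≥ 0` on every admissible datum (`mainTermForm_le_jumpMainTerm`,
`jumpMainTerm_nonneg`), so no M1 design has a negative main term (`not_jumpCloses_of_kernel_nonneg`) — a jump can
only ADD to `C₂₃₂`/OBJ_pos; and the converse shape `jumpCloses_iff` locating what a closing M1 design would need
(`κ(z₀) < 0` somewhere, against the derivation's claim).
References: Zhang, arXiv:2211.02515v1, §2 (2.16)–(2.20), §7 Prop 7.1 (7.2), §8 (8.3), §10 Lemma 10.1 (10.5),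
(10.11) [cite: Zhang2022LandauSiegel, §7 Prop 7.1 (7.2); §10 Lemma 10.1 (10.5)].
«The programme SEARCHES and TYPES; no claim about Landau–Siegel zeros, Theorems 1–2 of arXiv:2211.02515 or a
repaired Margin232 until a kernel theorem says so.»
-/

noncomputable section

open Complex Real ComplexConjugate Set
open _root_.MeasureTheory

namespace Literature.NumberTheory.LFunctions.Zhang2022

namespace KnifeEdge

open Repair Skeleton

/-! ### Part 1 — jump data and the balanced profile -/

/-- The sharp step `𝟙_{[0,z₀)}` on the logarithmic scale: the profile of a coefficient piece `χψ(n)`, `n < P^{z₀}`,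
cut off sharply at `n = P^{z₀}`. [cite: Zhang2022LandauSiegel, §7 (7.2); §10 (10.5)] -/
def stepFun (z₀ : ℝ) : ℝ → ℂ := (Ico (0:ℝ) z₀).indicator fun _ => 1

/-- `𝟙_{[0,z₀)}(z) = 1` for `0 ≤ z < z₀`. [cite: Zhang2022LandauSiegel, §7 (7.2)] -/
theorem stepFun_of_mem {z₀ z : ℝ} (hz : z ∈ Ico (0:ℝ) z₀) : stepFun z₀ z = 1 := by
  simp [stepFun, hz]

/-- `𝟙_{[0,z₀)}(z) = 0` off `[0,z₀)`. [cite: Zhang2022LandauSiegel, §7 (7.2)] -/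
theorem stepFun_of_not_mem {z₀ z : ℝ} (hz : z ∉ Ico (0:ℝ) z₀) : stepFun z₀ z = 0 := by
  simp [stepFun, hz]

/-- **Jump data** of an M1 design: a continuous part `u` with marked right derivative `u′` (meant to be a
one-sided kinked profile on `[0,1]`, see `JumpData.Admissible`) and `n` sharp steps at heights `pos i = z_i` with
BALANCED amplitudes `coef i = c_i` (the actual step height at modulus `D` is `c_i·Λ(D,χ)^{−1/2}`).
[cite: Zhang2022LandauSiegel, §7 (7.2); §10 Lemma 10.1 (10.5)] -/
structure JumpData where
  /-- number of interior jumps -/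
  n : ℕ
  /-- the continuous (kinked) part `u` -/
  cont : ℝ → ℂ
  /-- its marked right derivative `u′` -/
  cont' : ℝ → ℂ
  /-- jump heights `z_i` on the logarithmic scale -/
  pos : Fin n → ℝ
  /-- balanced jump amplitudes `c_i` -/
  coef : Fin n → ℂ

/-- Admissibility of jump data (sub-class M1): `u` is a one-sided kinked profile on `[0,1]` (`KinkedProfile`,
`u(1) = 0`: inside the validated calculus) and every jump is INTERIOR, `0 < z_i < 1` (jumps at the wall `z = 1`
are the band/wall rows E-005/E-multi-band, not this one). [cite: Zhang2022LandauSiegel, §7 (7.2); §10 (10.5)] -/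
structure JumpData.Admissible (J : JumpData) : Prop where
  kinked : KinkedProfile J.cont J.cont'
  top : J.cont 1 = 0
  interior : ∀ i, J.pos i ∈ Ioo (0:ℝ) 1

/-- The BALANCED profile at scale `Λ > 0`: `g_Λ(z) = u(z) + Σ_i c_i·Λ^{−1/2}·𝟙_{[0,z_i)}(z)`.
[cite: Zhang2022LandauSiegel, §7 (7.2); §10 Lemma 10.1 (10.5)] -/
def JumpData.profile (J : JumpData) (Λ : ℝ) (z : ℝ) : ℂ :=
  J.cont z + ∑ i, J.coef i * (((Real.sqrt Λ)⁻¹ : ℝ) : ℂ) * stepFun (J.pos i) z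

/-- **The balanced jump main term** `𝔅(u) + Σ_i |c_i|²·κ(z_i)` for a jump kernel `κ` (the claimed main-order
constant, in units of `𝔞𝔓`, of the discrete mean of the balanced profile polynomial).
[cite: Zhang2022LandauSiegel, §7 Prop 7.1 (7.2); §10 Lemma 10.1 (10.5)] -/
def jumpMainTerm (κ : ℝ → ℝ) (J : JumpData) : ℝ :=
  mainTermForm J.cont J.cont' + ∑ i, ‖J.coef i‖ ^ 2 * κ (J.pos i)

/-- Unfolding lemma. [cite: Zhang2022LandauSiegel, §7 Prop 7.1 (7.2)] -/
theorem jumpMainTerm_def (κ : ℝ → ℝ) (J : JumpData) :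
    jumpMainTerm κ J = mainTermForm J.cont J.cont' + ∑ i, ‖J.coef i‖ ^ 2 * κ (J.pos i) := rfl

/-- Without jumps the balanced main term is `𝔅(u)`. [cite: Zhang2022LandauSiegel, §7 Prop 7.1 (7.2)] -/
theorem jumpMainTerm_of_isEmpty (κ : ℝ → ℝ) (J : JumpData) [IsEmpty (Fin J.n)] :
    jumpMainTerm κ J = mainTermForm J.cont J.cont' := by
  simp [jumpMainTerm]

/-! ### Part 2 — registry row multi-E1 (E-multi-jump): the statement, parametric in `κ` and `Λ` (bare `Prop`s) -/

/-- **E-multi-jump — the interior-jump asymptotic in the balanced reading** (B-multi/EDLIST.md row multi-E1;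
status: derivation, in-house, unreviewed): under (A), for every admissible jump datum `J` and every `ε > 0`, for all
large `D` and every primitive quadratic `χ (mod D)`, the discrete mean of the profile polynomial of length `⌈P⌉` of
the balanced profile `u + Σ_i c_iΛ(D,χ)^{−1/2}𝟙_{[0,z_i)}` satisfies
`|mean − (𝔅(u) + Σ_i |c_i|²κ(z_i))·𝔞𝔓| ≤ ε·𝔞𝔓`. The jump kernel `κ` (claimed explicit and `> 0`: the trivial
diagonal, a `|·|²` term — `JumpKernelPos`) and the balancing scale `Λ(D,χ)` (claimed `≍ 𝓛^{1.1}/(𝔞𝓛⁻⁹)`) are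
PARAMETERS: no closed form is derived in print or in the cell's files; a derivation instantiates them. Shape of
`KnifeEdge.EStarLen` (same `discMean`/`profPoly`/`𝔞𝔓` normalisation). Nothing is asserted.
[cite: Zhang2022LandauSiegel, §7 Prop 7.1 (7.2); §10 Lemma 10.1 (10.5)] -/
def EMultiJump (c' : ℝ) (κ : ℝ → ℝ) (Λ : (D : ℕ) → DirichletCharacter ℂ D → ℝ) : Prop :=
  ∀ J : JumpData, J.Admissible → ∀ ε : ℝ, 0 < ε → ForAllLarge fun D _ χ => AssumptionA D χ →
    |discMean c' χ (fun x s => profPoly χ x (J.profile (Λ D χ)) ⌈bigP D⌉₊ s)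
        - jumpMainTerm κ J * frakA χ * frakP D| ≤ ε * frakA χ * frakP D

/-- **The claimed sign of the jump kernel** (part of the row's informal statement: «κ(z₀) > 0 explicit», every
interior height): a bare predicate on the parameter. [cite: Zhang2022LandauSiegel, §10 Lemma 10.1 (10.5)] -/
def JumpKernelPos (κ : ℝ → ℝ) : Prop := ∀ z ∈ Ioo (0:ℝ) 1, 0 < κ z

/-- **An M1 design CLOSING by positivity** would be an admissible jump datum with NEGATIVE balanced main term
(the family's POS currency, OBJECTIVE.md §2.1, for sub-class M1). [cite: Zhang2022LandauSiegel, §7 Prop 7.1 (7.2)] -/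
def JumpCloses (κ : ℝ → ℝ) : Prop := ∃ J : JumpData, J.Admissible ∧ jumpMainTerm κ J < 0

/-! ### Part 3 — PROVED: the sign bookkeeping that decides sub-class M1 given `κ ≥ 0` -/

/-- The jump sum is `≥ 0` whenever `κ ≥ 0` at the jump heights. [cite: Zhang2022LandauSiegel, §10 (10.5)] -/
theorem jumpSum_nonneg {κ : ℝ → ℝ} (J : JumpData) (hκ : ∀ i, 0 ≤ κ (J.pos i)) :
    0 ≤ ∑ i, ‖J.coef i‖ ^ 2 * κ (J.pos i) :=
  Finset.sum_nonneg fun i _ => mul_nonneg (sq_nonneg _) (hκ i)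

/-- **A jump can only add:** `𝔅(u) ≤ 𝔅(u) + Σ|c_i|²κ(z_i)` for `κ ≥ 0` at the jump heights.
[cite: Zhang2022LandauSiegel, §7 Prop 7.1 (7.2); §10 (10.5)] -/
theorem mainTermForm_le_jumpMainTerm {κ : ℝ → ℝ} (J : JumpData) (hκ : ∀ i, 0 ≤ κ (J.pos i)) :
    mainTermForm J.cont J.cont' ≤ jumpMainTerm κ J := by
  rw [jumpMainTerm]
  have := jumpSum_nonneg J hκ
  linarith

/-- **The balanced main term of an admissible M1 design is `≥ 0`** whenever the kernel is `≥ 0` on `(0,1)`: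
`𝔅(u) ≥ 0` on one-sided kinked profiles (`MainTermFormH1.mainTermForm_nonneg_of_isH1`) plus a non-negative jump
sum — LEVERS §0.6 (B1) for this sub-class. [cite: Zhang2022LandauSiegel, §7 Prop 7.1 (7.2); §10 (10.5)] -/
theorem jumpMainTerm_nonneg {κ : ℝ → ℝ} (hκ : ∀ z ∈ Ioo (0:ℝ) 1, 0 ≤ κ z) {J : JumpData}
    (hJ : J.Admissible) : 0 ≤ jumpMainTerm κ J := by
  have h1 : 0 ≤ mainTermForm J.cont J.cont' := mainTermForm_nonneg_of_isH1 hJ.kinked.isH1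
  have h2 := mainTermForm_le_jumpMainTerm J (κ := κ) fun i => hκ _ (hJ.interior i)
  linarith

/-- **Sub-class M1 is decided «no» in the POS currency once `κ ≥ 0`:** no admissible interior-jump design has a
negative balanced main term. (With `JumpKernelPos κ`, a fortiori.) [cite: Zhang2022LandauSiegel, §7 Prop 7.1 (7.2)] -/
theorem not_jumpCloses_of_kernel_nonneg {κ : ℝ → ℝ} (hκ : ∀ z ∈ Ioo (0:ℝ) 1, 0 ≤ κ z) : ¬ JumpCloses κ := by
  rintro ⟨J, hJ, hneg⟩
  exact not_lt.2 (jumpMainTerm_nonneg hκ hJ) hneg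

/-- The claimed sign suffices. [cite: Zhang2022LandauSiegel, §10 Lemma 10.1 (10.5)] -/
theorem not_jumpCloses_of_jumpKernelPos {κ : ℝ → ℝ} (hκ : JumpKernelPos κ) : ¬ JumpCloses κ :=
  not_jumpCloses_of_kernel_nonneg fun z hz => (hκ z hz).le

/-- **What a closing M1 design would need:** if some admissible datum has a negative balanced main term, then the
kernel is negative at one of its (interior) jump heights — the derivation's sign claim is exactly what is bet
against. [cite: Zhang2022LandauSiegel, §7 Prop 7.1 (7.2); §10 (10.5)] -/
theorem exists_kernel_neg_of_jumpCloses {κ : ℝ → ℝ} (h : JumpCloses κ) :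
    ∃ z ∈ Ioo (0:ℝ) 1, κ z < 0 := by
  by_contra hcon
  push Not at hcon
  exact not_jumpCloses_of_kernel_nonneg hcon h

end KnifeEdge

end Literature.NumberTheory.LFunctions.Zhang2022
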